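import Literature.NumberTheory.DiophantineGeometry.StewartYuPadicLogFormsProofs

/-!
# Stewart 2013, Lemma 5 over `ℚ` from Yu's bound: steps (17)–(19) proved, and the glue to the named fact

Topic `NumberTheory/DiophantineGeometry`; namespace `Literature.NumberTheory.DiophantineGeometry.Dioph`.

Third file of the named fact `Stewart2013_lemma5_rat` (`StewartYuPadicLogForms.lean`), on top of
`StewartYuPadicLogFormsProofs.lean`. Everything here is **proved**; the two definitions are the
real-valued printed quantities `C₁` and `G₁` of Stewart's proof, and no named fact is introduced:
Yu's bound enters only as the HYPOTHESIS of the `…_of_printedYuBound` / `…_of_yuBound` theorems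
(the pattern of `BakerWustholz1993.baker_wustholz_of_printed` in `AbcBakerWustholzReduction.lean`).

## The printed argument (C. L. Stewart, Acta Math. 211 (2013), proof of Lemma 3.1, pp. 301–302 = arXiv:1008.1274, proof of Lemma 5, p. 8)

Stewart applies the Main Theorem of K. Yu (Acta Math. 211 (2013) 315–382; stated for `n ≥ 2`)
with `c⁽¹⁾ = 1794`, `a⁽¹⁾ = 7(p−1)/(p−2)`, `a₀⁽¹⁾ = 2 + log 7`, `a₁⁽¹⁾ = a₂⁽¹⁾ = 5.25` and Voutier's
explicit Dobrowolski bound, and records ("Therefore we find that")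

  `ord_℘(α₁^{b₁}⋯αₙ^{bₙ} − 1) < C₁ h(α₁)⋯h(αₙ) max(log B, G₁, (n+1) f_℘ log p)`,          (P)
  `G₁ = (n+1)((2 + log 7)n + 5.25 + log((2 + log 7)n + 5.25) + log d)`,
  `C₁ = 1794 (7 (p−1)/(p−2))ⁿ ((n+1)^{n+1}/n!) · d^{n+2} log* d / (2^u (f_℘ log p)²)
        · max(p^{f_℘} δ⁻¹ (n/(f_℘ log p))ⁿ, eⁿ f_℘ log p) · max(log(e⁴(n+1)d), f_℘ log p)`,

then `2^u ≥ 2`, `f_℘ log p ≥ log 5`, Stirling `(n+1)^{n+1}/n! ≤ e^{n+1}(n+1)^{1/2}/√(2π)` ((17),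
(18) = (3.2), (3.3): `C₂ = (1794/2)(e/√(2π)) (n+1)^{1/2} (7e(p−1)/(p−2))ⁿ d^{n+2} log*d · max(⋯) ·
log(e⁴(n+1)d)/log 5`), and finally `G₁ ≤ (n+1)(5.4n + log d)` ((19) = (3.4)), giving Lemma 5 with
`C = 376 ⋯` (`C₂/log 5`, `(1794/2)(e/√(2π))/(log 5)² = 375.55… ≤ 376`). Yu's PUBLISHED constants
for `d = 1` ([Yu2013, §1.3, (1.28), (1.30), (1.31), case (III.2)]) are `c⁽¹⁾ = 1790`,
`a₁⁽¹⁾ = a₂⁽¹⁾ = 5.84`; accordingly the named fact is stated (since 2026-08-15) with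
`G₁^ℚ(n) = yuG1Rat n` (`5.84`) and in the (3.2)–(3.3) form `max(log B, G₁^ℚ(n))`, see the
*Restatement record* in `StewartYuPadicLogForms.lean`.

For `K = ℚ` (`d = 1`, `f_℘ = 1`, `u = 1` so `2^u = 2` exactly) this file defines `stewartC1 n p δ`
(= `C₁`) and `stewartG1 n` (= Stewart's `G₁`, with `5.25`) and PROVES:

* `stirling_succ_pow_div_factorial_le` — `(n+1)^{n+1}/n! ≤ e^{n+1} √(n+1)/√(2π)` (from Mathlib's
  `Stirling.le_factorial_stirling`);
* `log_five_gt_d4` — `1.6089 < log 5`; `stewart_kappa_lt` — `1794 e/(2√(2π)) < 972.8`; hence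
  `C₁ ≤ 972.8 · (n+1)^{1/2}(7e(p−1)/(p−2))ⁿ max(⋯) · max(log(e⁴(n+1)), log p)/(log p)²` and
  `972.8 ≤ 376 (log p)²` for `p ≥ 5` — the printed constant `376` is thereby verified, with a margin
  of `0.06%` at `p = 5`;
* `Stewart2013_lemma5_rat_maxG_of_printedYuBound` — **steps (17)–(18) for every `n ≥ 2` and every
  second term `G ≥ 15(n+1)`: `ord_p(Ξ − 1) < C₁ ∏h(αᵢ) max(log B, G, (n+1) log p)` implies
  `ord_p(Ξ − 1) < C ∏h(αᵢ) max(log B, G)`** with Stewart's `C = stewartC n p δ`; specialised to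
  Stewart's `G₁` in `Stewart2013_lemma5_rat_G1_of_printedYuBound` and to Yu's `G₁^ℚ` in the glue;
* `yuG1Rat_le_printed` / `printed_le_yuG1Rat` — with Yu's published `5.84` the printed step (19)
  `G₁^ℚ(n) ≤ (n+1) · 5.4n` holds for `n ≥ 7`, while `(n+1) · 5.4n ≤ G₁^ℚ(n)` for `n ≤ 6` (with
  Stewart's `5.25` the threshold is `n = 6`: `stewart_G1_le` / `stewart_G1_gt` in the Proofs file);
* `Stewart2013_lemma5_rat_of_yuBound` — **THE GLUE: if Yu's Theorem I over `ℚ` holds in the display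
  form (P) with Yu's published `G₁(n,1)` (hypothesis `H`, all `n ≥ 2`), then the named fact
  `Stewart2013_lemma5_rat` holds** (for `n ≤ 1` by the elementary
  `Stewart2013_lemma5_rat_of_le_one` and `printed_le_yuG1Rat`). A future formalisation of
  [Yu2013, Theorem I] at `d = 1` therefore discharges the fact at once;
* `Stewart2013_lemma5_rat.printed_of` — conversely the fact yields the PRINTED form of Lemma 5 over
  `ℚ` (`max(log B, (n+1) · 5.4n)`) whenever `7 ≤ n`, or `n ≤ 1`, or `B ≤ 10⁸`;
* `Stewart2013_lemma5_rat_of_printedYuBound` — (P) with Stewart's `5.25` for all `n ≥ 2` implies the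
  printed form for every `n` with `n ≤ 1 ∨ 6 ≤ n` (kept from the first version of this file).

Nothing of Yu's theorem is proved here.

## References

* [Stewart2013] C. L. Stewart, *On divisors of Lucas and Lehmer numbers*, Acta Math. 211 (2013),
  291–314 (arXiv:1008.1274), §3, proof of Lemma 5, displays (17)–(19) (p. 8) = Acta Lemma 3.1,
  (3.2)–(3.4) (pp. 301–302).
* [Yu2013] K. Yu, *p-adic logarithmic forms and a problem of Erdős*, Acta Math. 211 (2013),
  315–382, Main Theorem (1.18) with (1.9), (1.11), (1.13)–(1.15); §1.3 (1.28)–(1.31); §1.4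
  Theorem I.
* M. Abramowitz, I. Stegun, *Handbook of Mathematical Functions*, 6.1.38 (Stirling), as cited in
  [Stewart2013].
-/

open Height Real Finset

noncomputable section

namespace Literature.NumberTheory.DiophantineGeometry.Dioph

/-! ### The printed quantities `G₁` and `C₁` for `d = 1` -/

/-- Stewart's `G₁` for `d = 1`: `G₁ = (n+1)((2 + log 7)n + 5.25 + log((2 + log 7)n + 5.25))`
(`a₀⁽¹⁾ = 2 + log 7`, `a₁⁽¹⁾ = a₂⁽¹⁾ = 5.25`, `log d = 0`).
[cite: Stewart2013, proof of Lemma 5 (display after (17))] -/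
def stewartG1 (n : ℕ) : ℝ :=
  ((n : ℝ) + 1) * ((2 + Real.log 7) * n + 5.25 + Real.log ((2 + Real.log 7) * n + 5.25))

/-- Unfolding lemma for `stewartG1`. [cite: Stewart2013, proof of Lemma 5] -/
theorem stewartG1_def (n : ℕ) : stewartG1 n =
    ((n : ℝ) + 1) * ((2 + Real.log 7) * n + 5.25 + Real.log ((2 + Real.log 7) * n + 5.25)) :=
  rfl

/-- Stewart's `C₁` for `d = 1`, `f_℘ = 1`, `2^u = 2` (`K = ℚ`: `ζ₂ ∈ ℚ`, `ζ₄ ∉ ℚ`), as a function of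
`n`, `p` and `δ`:
`C₁ = 1794 (7(p−1)/(p−2))ⁿ ((n+1)^{n+1}/n!) · (1/(2 (log p)²)) · max(p δ⁻¹ (n/log p)ⁿ, eⁿ log p)
      · max(log(e⁴(n+1)), log p)`.
[cite: Stewart2013, proof of Lemma 5 (display before (17))] -/
def stewartC1 (n p : ℕ) (δ : ℝ) : ℝ :=
  1794 * (7 * (((p : ℝ) - 1) / ((p : ℝ) - 2))) ^ n * (((n : ℝ) + 1) ^ (n + 1) / (n.factorial : ℝ)) *
    (1 / (2 * Real.log p ^ 2)) *
    max ((p : ℝ) / δ * ((n : ℝ) / Real.log p) ^ n) (Real.exp n * Real.log p) *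
    max (Real.log (Real.exp 4 * (n + 1))) (Real.log p)

/-- Unfolding lemma for `stewartC1`. [cite: Stewart2013, proof of Lemma 5] -/
theorem stewartC1_def (n p : ℕ) (δ : ℝ) : stewartC1 n p δ =
    1794 * (7 * (((p : ℝ) - 1) / ((p : ℝ) - 2))) ^ n * (((n : ℝ) + 1) ^ (n + 1) / (n.factorial : ℝ)) *
      (1 / (2 * Real.log p ^ 2)) *
      max ((p : ℝ) / δ * ((n : ℝ) / Real.log p) ^ n) (Real.exp n * Real.log p) *
      max (Real.log (Real.exp 4 * (n + 1))) (Real.log p) :=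
  rfl

/-! ### Stirling in Stewart's form (6.1.38 of Abramowitz–Stegun) -/

/-- **Stirling's bound as used by Stewart**: `(n+1)^{n+1}/n! ≤ e^{n+1} √(n+1) / √(2π)`, from
`(n+1)! ≥ √(2π(n+1)) ((n+1)/e)^{n+1}` (Mathlib `Stirling.le_factorial_stirling`).
[cite: Stewart2013, proof of Lemma 5 (display before (17))] -/
theorem stirling_succ_pow_div_factorial_le (n : ℕ) :
    ((n : ℝ) + 1) ^ (n + 1) / (n.factorial : ℝ) ≤
      Real.exp 1 ^ (n + 1) * Real.sqrt ((n : ℝ) + 1) / Real.sqrt (2 * π) := by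
  set T : ℝ := (n : ℝ) + 1 with hT
  have hT0 : 0 < T := by positivity
  have hfac0 : (0 : ℝ) < (n.factorial : ℝ) := by exact_mod_cast n.factorial_pos
  have hE : 0 < Real.exp 1 := Real.exp_pos 1
  have h2pi : 0 < Real.sqrt (2 * π) := Real.sqrt_pos.mpr (by positivity)
  have hsT : 0 < Real.sqrt T := Real.sqrt_pos.mpr hT0
  -- Stirling for `(n+1)!`
  have hSt : Real.sqrt (2 * π * T) * (T / Real.exp 1) ^ (n + 1) ≤ T * (n.factorial : ℝ) := by
    have h := Stirling.le_factorial_stirling (n + 1)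
    have hcast : (((n + 1 : ℕ) : ℝ)) = T := by rw [hT]; push_cast; ring
    have hfac : (((n + 1).factorial : ℕ) : ℝ) = T * (n.factorial : ℝ) := by
      rw [Nat.factorial_succ]; push_cast; rw [hT]
    rw [hcast, hfac] at h
    exact h
  have hsq : Real.sqrt (2 * π * T) = Real.sqrt (2 * π) * Real.sqrt T :=
    Real.sqrt_mul (by positivity) T
  have hTT : Real.sqrt T * Real.sqrt T = T := Real.mul_self_sqrt hT0.le
  -- rewrite Stirling as `√(2π) √T T^{n+1} ≤ e^{n+1} T n!`
  have h1 : Real.sqrt (2 * π) * Real.sqrt T * T ^ (n + 1) ≤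
      Real.exp 1 ^ (n + 1) * (T * (n.factorial : ℝ)) := by
    have hpow : (T / Real.exp 1) ^ (n + 1) = T ^ (n + 1) / Real.exp 1 ^ (n + 1) := div_pow _ _ _
    rw [hsq, hpow] at hSt
    have hEp : 0 < Real.exp 1 ^ (n + 1) := pow_pos hE _
    have := mul_le_mul_of_nonneg_right hSt hEp.le
    calc Real.sqrt (2 * π) * Real.sqrt T * T ^ (n + 1)
        = Real.sqrt (2 * π) * Real.sqrt T * (T ^ (n + 1) / Real.exp 1 ^ (n + 1)) *
            Real.exp 1 ^ (n + 1) := by field_simp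
      _ ≤ T * (n.factorial : ℝ) * Real.exp 1 ^ (n + 1) := this
      _ = Real.exp 1 ^ (n + 1) * (T * (n.factorial : ℝ)) := by ring
  -- cancel `√T`
  have h2 : Real.sqrt (2 * π) * T ^ (n + 1) ≤ Real.exp 1 ^ (n + 1) * Real.sqrt T * (n.factorial : ℝ) := by
    have h1' : Real.sqrt T * (Real.sqrt (2 * π) * T ^ (n + 1)) ≤
        Real.sqrt T * (Real.exp 1 ^ (n + 1) * Real.sqrt T * (n.factorial : ℝ)) := by
      calc Real.sqrt T * (Real.sqrt (2 * π) * T ^ (n + 1))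
          = Real.sqrt (2 * π) * Real.sqrt T * T ^ (n + 1) := by ring
        _ ≤ Real.exp 1 ^ (n + 1) * (T * (n.factorial : ℝ)) := h1
        _ = Real.sqrt T * (Real.exp 1 ^ (n + 1) * Real.sqrt T * (n.factorial : ℝ)) := by
            rw [show Real.sqrt T * (Real.exp 1 ^ (n + 1) * Real.sqrt T * (n.factorial : ℝ)) =
              Real.exp 1 ^ (n + 1) * ((Real.sqrt T * Real.sqrt T) * (n.factorial : ℝ)) by ring, hTT]
    exact le_of_mul_le_mul_left h1' hsT
  rw [div_le_div_iff₀ hfac0 h2pi]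
  linarith

/-! ### Numerical constants: `log 5`, `√(2π)` and Stewart's `(1794/2)(e/√(2π)) < 972.8 ≤ 376 (log 5)²` -/

/-- `1.6089 < log 5` (`log 5 = 2 log 2 + log(5/4)` and four terms of the series for `log(1 − 1/5)`).
[folklore] -/
theorem log_five_gt_d4 : (1.6089 : ℝ) < Real.log 5 := by
  have h := Real.abs_log_sub_add_sum_range_le (show |(1 / 5 : ℝ)| < 1 by norm_num) 4
  norm_num [Finset.sum_range_succ] at h
  have h45 : Real.log (4 / 5) = Real.log 4 - Real.log 5 :=
    Real.log_div (by norm_num) (by norm_num)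
  have h4 : Real.log 4 = 2 * Real.log 2 := by
    rw [show (4 : ℝ) = 2 ^ 2 by norm_num, Real.log_pow]; norm_num
  have hl2 := Real.log_two_gt_d9
  have hab := (abs_le.mp h).2
  linarith

/-- `log 5 ≤ log p` for `p ≥ 5`, hence `1.6089 < log p`. [folklore] -/
theorem log_gt_d4_of_five_le {p : ℕ} (hp5 : 5 ≤ p) : (1.6089 : ℝ) < Real.log p :=
  lt_of_lt_of_le log_five_gt_d4 (Real.log_le_log (by norm_num) (by exact_mod_cast hp5))

/-- `2.50662 ≤ √(2π)` (`π > 3.141592`). [folklore] -/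
theorem sqrt_two_pi_gt : (2.50662 : ℝ) ≤ Real.sqrt (2 * π) := by
  have hpi := Real.pi_gt_d6
  rw [show (2.50662 : ℝ) = Real.sqrt (2.50662 ^ 2) by rw [Real.sqrt_sq (by norm_num)]]
  exact Real.sqrt_le_sqrt (by nlinarith)

/-- **Stewart's numerical constant**: `(1794/2)(e/√(2π)) < 972.8` (the true value is `972.74…`;
Stewart's `C = 376⋯` is `⌈(1794/2)(e/√(2π))/(log 5)²⌉ = ⌈375.55…⌉`).
[cite: Stewart2013, proof of Lemma 5 ((18))] -/
theorem stewart_kappa_lt : 1794 * Real.exp 1 / (2 * Real.sqrt (2 * π)) < 972.8 := by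
  have he := Real.exp_one_lt_d9
  have hs := sqrt_two_pi_gt
  have hs0 : 0 < 2 * Real.sqrt (2 * π) := by linarith
  rw [div_lt_iff₀ hs0]
  nlinarith

/-- `972.8 ≤ 376 (log p)²` for `p ≥ 5` (`376 · 1.6089² = 973.29…`): the margin by which the
printed constant `376` suffices. [cite: Stewart2013, Lemma 5] -/
theorem stewart_const_le_log_sq {p : ℕ} (hp5 : 5 ≤ p) : (972.8 : ℝ) ≤ 376 * Real.log p ^ 2 := by
  have hL := log_gt_d4_of_five_le hp5
  nlinarith

/-! ### `G₁ ≥ 15 (n+1)` and the key real inequality -/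

/-- `G₁ ≥ 15 (n+1)` for `n ≥ 2` (`(2 + log 7)n + 5.25 ≥ 13.05` and its logarithm is `≥ 2`).
[cite: Stewart2013, proof of Lemma 5] -/
theorem stewartG1_ge {n : ℕ} (hn : 2 ≤ n) : 15 * ((n : ℝ) + 1) ≤ stewartG1 n := by
  rw [stewartG1_def]
  have hn0 : (0 : ℝ) ≤ n + 1 := by positivity
  have hnR : (2 : ℝ) ≤ n := by exact_mod_cast hn
  have ha : (1.9 : ℝ) < Real.log 7 := log_seven_gt_d1
  set x := (2 + Real.log 7) * n + 5.25 with hx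
  have hx13 : (13.05 : ℝ) < x := by rw [hx]; nlinarith
  have hlog2 : (2 : ℝ) < Real.log x := by
    rw [Real.lt_log_iff_exp_lt (by linarith)]
    linarith [exp_two_lt_d2]
  rw [mul_comm]
  apply mul_le_mul_of_nonneg_left _ hn0
  linarith

/-- **The key real inequality of the reduction**: if `L ≥ 1.6089`, `A ≥ 4`, `T ≥ 3` and
`M ≥ 15 T`, then `972.8 · max(A, L) · max(M, T L) ≤ 376 · A · L² · M` (four cases).
[folklore] -/
theorem stewart_reduction_key {L A M T : ℝ} (hL : 1.6089 ≤ L) (hA : 4 ≤ A) (hT : 3 ≤ T)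
    (hM : 15 * T ≤ M) : 972.8 * max A L * max M (T * L) ≤ 376 * A * L ^ 2 * M := by
  have hL0 : 0 < L := by linarith
  have hA0 : 0 < A := by linarith
  have hT0 : 0 < T := by linarith
  have hM0 : 0 < M := by linarith
  have hL2 : 972.8 ≤ 376 * L ^ 2 := by nlinarith
  rcases le_total L A with hLA | hAL
  · rw [max_eq_left hLA]
    rcases le_total (T * L) M with h1 | h2
    · rw [max_eq_left h1]
      have hAM : 0 ≤ A * M := by positivity
      nlinarith [mul_le_mul_of_nonneg_right hL2 hAM]
    · rw [max_eq_right h2]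
      -- `972.8 A T L ≤ 376 A L² M`, using `M ≥ 15 T` and `L ≥ 1.6`
      have h3 : 972.8 * L ≤ 376 * L ^ 2 * 15 := by nlinarith
      have hAT : 0 ≤ A * T := by positivity
      have h4 : 376 * A * L ^ 2 * (15 * T) ≤ 376 * A * L ^ 2 * M :=
        mul_le_mul_of_nonneg_left hM (by positivity)
      nlinarith [mul_le_mul_of_nonneg_right h3 hAT]
  · rw [max_eq_right hAL]
    rcases le_total (T * L) M with h1 | h2
    · rw [max_eq_left h1]
      -- `972.8 L M ≤ 376 A L² M`, using `A L ≥ 6.4`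
      have h3 : 972.8 ≤ 376 * A * L := by nlinarith
      have hLM : 0 ≤ L * M := by positivity
      nlinarith [mul_le_mul_of_nonneg_right h3 hLM]
    · rw [max_eq_right h2]
      -- `972.8 L (T L) ≤ 376 A L² M`, using `A M ≥ 60 T`
      have h3 : 972.8 * T ≤ 376 * A * (15 * T) := by nlinarith
      have h4 : 376 * A * (15 * T) ≤ 376 * A * M := mul_le_mul_of_nonneg_left hM (by positivity)
      have hLL : 0 ≤ L ^ 2 := by positivity
      nlinarith [mul_le_mul_of_nonneg_right (h3.trans h4) hLL]

/-! ### Lemma 5 over `ℚ` from the printed bound (P) -/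

/-- **Steps (17)–(18) of Stewart's proof, for every `n ≥ 2` and an abstract second term
`G ≥ 15(n+1)` (proved):** `ord_p(Ξ − 1) < C₁ h(α₁)⋯h(αₙ) max(log B, G, (n+1) log p)` implies
`ord_p(Ξ − 1) < C h(α₁)⋯h(αₙ) max(log B, G)` with Stewart's constant `C = stewartC n p δ`
(`δ = stewartDelta p α`). Proof: Stirling (`stirling_succ_pow_div_factorial_le`) gives
`C₁ ≤ (1794/2)(e/√(2π)) √(n+1) (7e(p−1)/(p−2))ⁿ max(⋯) · max(log(e⁴(n+1)), log p)/(log p)²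
< 972.8 ⋯`, and `972.8 · max(log(e⁴(n+1)), log p) · max(M₁, (n+1) log p) ≤ 376 · log(e⁴(n+1)) ·
(log p)² · M₁` for `M₁ = max(log B, G) ≥ G ≥ 15(n+1)` (`stewart_reduction_key`, using
`log p ≥ log 5 > 1.6089`). Only `αᵢ ≠ 0` and multiplicative independence (forcing `h(αᵢ) ≥ log 2`,
so `∏ h(αᵢ) > 0`) are needed from the hypotheses of Lemma 5. Used with `G = stewartG1 n`
(Stewart's printed `G₁`, next theorem) and with `G = yuG1Rat n` (Yu's published `G₁(n,1)`, in
`Stewart2013_lemma5_rat_of_yuBound`). [cite: Stewart2013, proof of Lemma 5, (17)–(18)] -/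
theorem Stewart2013_lemma5_rat_maxG_of_printedYuBound (n p : ℕ) (α : Fin n → ℚ) (b : Fin n → ℤ)
    (G : ℝ) (hn : 2 ≤ n) (hp5 : 5 ≤ p) (hα0 : ∀ i, α i ≠ 0)
    (hind : ∀ e : Fin n → ℤ, ∏ i, α i ^ e i = 1 → e = 0)
    (hG : 15 * ((n : ℝ) + 1) ≤ G)
    (hYu : (padicValRat p (∏ i, α i ^ b i - 1) : ℝ) <
      stewartC1 n p (stewartDelta p α) * (∏ i, logHeight₁ (α i)) *
        max (Real.log (stewartB b)) (max G ((n + 1) * Real.log p))) :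
    (padicValRat p (∏ i, α i ^ b i - 1) : ℝ) <
      stewartC n p (stewartDelta p α) * (∏ i, logHeight₁ (α i)) *
        max (Real.log (stewartB b)) G := by
  have hp' : (5 : ℝ) ≤ p := by exact_mod_cast hp5
  -- names
  set L := Real.log p with hLdef
  set δ := stewartDelta p α with hδdef
  set P := ∏ i, logHeight₁ (α i) with hPdef
  set M₁ := max (Real.log (stewartB b)) G with hM₁def
  set A := Real.log (Real.exp 4 * (n + 1)) with hAdef
  set F := ((p : ℝ) - 1) / ((p : ℝ) - 2) with hFdef
  set MX := max ((p : ℝ) / δ * ((n : ℝ) / L) ^ n) (Real.exp n * L) with hMXdef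
  set S := ((n : ℝ) + 1) ^ (n + 1) / (n.factorial : ℝ) with hSdef
  set W := Real.sqrt ((n : ℝ) + 1) * (7 * Real.exp 1 * F) ^ n * MX with hWdef
  -- basic bounds
  have hL : 1.6089 < L := log_gt_d4_of_five_le hp5
  have hL0 : 0 < L := by linarith
  have hE : 0 < Real.exp 1 := Real.exp_pos 1
  have hF1 : 1 ≤ F := by
    rw [hFdef, le_div_iff₀ (by linarith)]; linarith
  have hF0 : 0 ≤ F := by linarith
  have hA : 4 ≤ A := by
    rw [hAdef, Real.log_mul (Real.exp_pos 4).ne' (by positivity), Real.log_exp]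
    have : (0 : ℝ) ≤ Real.log (n + 1) :=
      Real.log_nonneg (by have : (0:ℝ) ≤ n := Nat.cast_nonneg n; linarith)
    linarith
  have hMX0 : 0 ≤ MX := le_trans (mul_nonneg (Real.exp_pos _).le hL0.le) (le_max_right _ _)
  have hW0 : 0 ≤ W := by
    rw [hWdef]
    exact mul_nonneg (mul_nonneg (Real.sqrt_nonneg _) (pow_nonneg (by positivity) _)) hMX0
  have hnR : (2 : ℝ) ≤ n := by exact_mod_cast hn
  have hT : (3 : ℝ) ≤ (n : ℝ) + 1 := by linarith
  -- heights: `h(αᵢ) ≥ log 2`, so `P > 0`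
  have hP0 : 0 < P := by
    rw [hPdef]
    refine Finset.prod_pos fun i _ => lt_of_lt_of_le ?_
      (log_two_le_logHeight₁ (hα0 i) (ne_one_and_ne_neg_one_of_multIndep hind i).1
        (ne_one_and_ne_neg_one_of_multIndep hind i).2)
    linarith [Real.log_two_gt_d9]
  -- `M₁ ≥ G ≥ 15 (n+1)`
  have hM : 15 * ((n : ℝ) + 1) ≤ M₁ := le_trans hG (le_max_right _ _)
  have hM0 : 0 < M₁ := by linarith
  have hM3 : max (Real.log (stewartB b)) (max G ((n + 1) * L)) =
      max M₁ (((n : ℝ) + 1) * L) := (max_assoc _ _ _).symm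
  -- `C₁ ≤ 972.8 · W · max(A, L) / L²`
  have hStir : S ≤ Real.exp 1 ^ (n + 1) * Real.sqrt ((n : ℝ) + 1) / Real.sqrt (2 * π) :=
    stirling_succ_pow_div_factorial_le n
  have h2pi : 0 < Real.sqrt (2 * π) := Real.sqrt_pos.mpr (by positivity)
  have hκ : 1794 * Real.exp 1 / (2 * Real.sqrt (2 * π)) < 972.8 := stewart_kappa_lt
  have hmx0 : 0 ≤ max A L := le_trans hL0.le (le_max_right _ _)
  have hC1 : stewartC1 n p δ ≤ 972.8 * W * (max A L / L ^ 2) := by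
    have hR0 : 0 ≤ 1794 * (7 * F) ^ n * (1 / (2 * L ^ 2)) * MX * max A L := by
      have : 0 ≤ (7 * F) ^ n := pow_nonneg (by linarith) _
      positivity
    calc stewartC1 n p δ = S * (1794 * (7 * F) ^ n * (1 / (2 * L ^ 2)) * MX * max A L) := by
          rw [stewartC1_def]; ring
      _ ≤ (Real.exp 1 ^ (n + 1) * Real.sqrt ((n : ℝ) + 1) / Real.sqrt (2 * π)) *
            (1794 * (7 * F) ^ n * (1 / (2 * L ^ 2)) * MX * max A L) :=
          mul_le_mul_of_nonneg_right hStir hR0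
      _ = (1794 * Real.exp 1 / (2 * Real.sqrt (2 * π))) *
            (Real.sqrt ((n : ℝ) + 1) * ((7 * F) ^ n * Real.exp 1 ^ n) * MX) *
            (max A L / L ^ 2) := by
          field_simp
          ring
      _ = (1794 * Real.exp 1 / (2 * Real.sqrt (2 * π))) * W * (max A L / L ^ 2) := by
          rw [hWdef, ← mul_pow]
          congr 3
          ring
      _ ≤ 972.8 * W * (max A L / L ^ 2) := by
          have : 0 ≤ W * (max A L / L ^ 2) := mul_nonneg hW0 (div_nonneg hmx0 (by positivity))
          nlinarith
  -- the key inequality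
  have hkey : 972.8 * max A L * max M₁ (((n : ℝ) + 1) * L) ≤ 376 * A * L ^ 2 * M₁ :=
    stewart_reduction_key hL.le hA hT hM
  -- `C = 376 √(n+1) (7eF)ⁿ A MX`
  have hC : stewartC n p δ = 376 * W * A := by
    rw [stewartC_def, hWdef]; ring
  -- assemble
  have hM30 : 0 ≤ max M₁ (((n : ℝ) + 1) * L) := le_trans hM0.le (le_max_left _ _)
  rw [hM3] at hYu
  calc (padicValRat p (∏ i, α i ^ b i - 1) : ℝ)
      < stewartC1 n p δ * P * max M₁ (((n : ℝ) + 1) * L) := hYu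
    _ ≤ 972.8 * W * (max A L / L ^ 2) * P * max M₁ (((n : ℝ) + 1) * L) := by
        apply mul_le_mul_of_nonneg_right _ hM30
        exact mul_le_mul_of_nonneg_right hC1 hP0.le
    _ = (972.8 * max A L * max M₁ (((n : ℝ) + 1) * L)) * (W * P / L ^ 2) := by
        field_simp
    _ ≤ (376 * A * L ^ 2 * M₁) * (W * P / L ^ 2) :=
        mul_le_mul_of_nonneg_right hkey (div_nonneg (mul_nonneg hW0 hP0.le) (by positivity))
    _ = 376 * W * A * P * M₁ := by
        field_simp
    _ = stewartC n p δ * P * M₁ := by rw [hC]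

/-- **Steps (17)–(18) of Stewart's proof, for every `n ≥ 2` (proved): the printed Yu–Voutier bound
(P) implies `ord_p(Ξ − 1) < C h(α₁)⋯h(αₙ) max(log B, G₁)`** with Stewart's constant
`C = stewartC n p δ` (`δ = stewartDelta p α`). Hypothesis `hYu` is the display (P) of the printed
proof ("Therefore we find that `ord_℘(α₁^{b₁}⋯αₙ^{bₙ} − 1) < C₁ h(α₁)⋯h(αₙ) max(log B, G₁,
(n+1) f_℘ log p)`") for `K = ℚ`, i.e. with `C₁ = stewartC1 n p δ`, `G₁ = stewartG1 n`, `f_℘ = 1` —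
Stewart obtains it from Yu's Main Theorem (which requires `n ≥ 2`) and Voutier's Dobrowolski
bound; it is NOT proved here. This is the case `G = G₁ = stewartG1 n` of
`Stewart2013_lemma5_rat_maxG_of_printedYuBound` (`stewartG1_ge : G₁ ≥ 15(n+1)`); it is what the
printed derivation yields for `2 ≤ n ≤ 5`, where step (19) fails (`stewart_G1_gt`).
[cite: Stewart2013, proof of Lemma 5, (17)–(18)] -/
theorem Stewart2013_lemma5_rat_G1_of_printedYuBound (n p : ℕ) (α : Fin n → ℚ) (b : Fin n → ℤ)
    (hn : 2 ≤ n) (hp5 : 5 ≤ p) (hα0 : ∀ i, α i ≠ 0)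
    (hind : ∀ e : Fin n → ℤ, ∏ i, α i ^ e i = 1 → e = 0)
    (hYu : (padicValRat p (∏ i, α i ^ b i - 1) : ℝ) <
      stewartC1 n p (stewartDelta p α) * (∏ i, logHeight₁ (α i)) *
        max (Real.log (stewartB b)) (max (stewartG1 n) ((n + 1) * Real.log p))) :
    (padicValRat p (∏ i, α i ^ b i - 1) : ℝ) <
      stewartC n p (stewartDelta p α) * (∏ i, logHeight₁ (α i)) *
        max (Real.log (stewartB b)) (stewartG1 n) := by
  exact Stewart2013_lemma5_rat_maxG_of_printedYuBound n p α b (stewartG1 n) hn hp5 hα0 hind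
    (stewartG1_ge hn) hYu

/-- **Stewart 2013, Lemma 5 over `ℚ` from the printed bound (P) (proved reduction):** if the
display (P) of the printed proof — the output of Yu's Main Theorem with Voutier's bound, for
`K = ℚ` — holds for all `n ≥ 2` (hypothesis `H`, in the exact shape of the named fact with
`stewartC1`/`max(log B, G₁, (n+1) log p)` in place of `stewartC`/`max(log B, (n+1) · 5.4n)`), then
the PRINTED statement of Lemma 5 over `ℚ` (`max(log B, (n+1) · 5.4n)`; this was the shape of the
named fact `Stewart2013_lemma5_rat` until its restatement on 2026-08-15) holds for every `n` with
`n ≤ 1 ∨ 6 ≤ n`: for `n ≥ 6` by `Stewart2013_lemma5_rat_G1_of_printedYuBound` and the printed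
step (19) `G₁ ≤ (n+1) · 5.4n`, valid exactly for `n ≥ 6` (`stewart_G1_le`); for `n ≤ 1`
unconditionally (`Stewart2013_lemma5_rat_of_le_one`). For `2 ≤ n ≤ 5` the printed argument
gives only the `max(log B, G₁)` form (previous theorem). The glue to the named fact itself (with
Yu's published `G₁(n,1)`) is `Stewart2013_lemma5_rat_of_yuBound` below; this theorem introduces
no named fact and proves nothing of (P). [cite: Stewart2013, Lemma 5 and its proof, (17)–(19)] -/
theorem Stewart2013_lemma5_rat_of_printedYuBound
    (H : ∀ (n p : ℕ) (α : Fin n → ℚ) (b : Fin n → ℤ), 2 ≤ n → p.Prime → 5 ≤ p →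
      (∀ i, α i ≠ 0 ∧ padicValRat p (α i) = 0) →
      (∀ e : Fin n → ℤ, ∏ i, α i ^ e i = 1 → e = 0) → b ≠ 0 →
      (padicValRat p (∏ i, α i ^ b i - 1) : ℝ) <
        stewartC1 n p (stewartDelta p α) * (∏ i, logHeight₁ (α i)) *
          max (Real.log (stewartB b)) (max (stewartG1 n) ((n + 1) * Real.log p)))
    (n p : ℕ) (α : Fin n → ℚ) (b : Fin n → ℤ) (hn : n ≤ 1 ∨ 6 ≤ n) (hp : p.Prime) (hp5 : 5 ≤ p)
    (hα : ∀ i, α i ≠ 0 ∧ padicValRat p (α i) = 0)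
    (hind : ∀ e : Fin n → ℤ, ∏ i, α i ^ e i = 1 → e = 0) (hb : b ≠ 0) :
    (padicValRat p (∏ i, α i ^ b i - 1) : ℝ) <
      stewartC n p (stewartDelta p α) * (∏ i, logHeight₁ (α i)) *
        max (Real.log (stewartB b)) ((n + 1) * (5.4 * n)) := by
  rcases hn with hn1 | hn6
  · exact Stewart2013_lemma5_rat_of_le_one n p hn1 α b hp hp5 hα hind hb
  have h1 := Stewart2013_lemma5_rat_G1_of_printedYuBound n p α b (by omega) hp5 (fun i => (hα i).1)
    hind (H n p α b (by omega) hp hp5 hα hind hb)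
  have hG : stewartG1 n ≤ ((n : ℝ) + 1) * (5.4 * n) := by
    rw [stewartG1_def]; exact stewart_G1_le hn6
  have hmax : max (Real.log (stewartB b)) (stewartG1 n) ≤
      max (Real.log (stewartB b)) (((n : ℝ) + 1) * (5.4 * n)) := max_le_max le_rfl hG
  have hC0 : 0 ≤ stewartC n p (stewartDelta p α) :=
    le_trans (by
      have hL : 0 ≤ Real.log p := Real.log_natCast_nonneg p
      positivity) (stewartC_ge n hp5 (stewartDelta p α))
  have hP0 : 0 ≤ ∏ i, logHeight₁ (α i) := Finset.prod_nonneg fun i _ => zero_le_logHeight₁ _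
  exact lt_of_lt_of_le h1 (mul_le_mul_of_nonneg_left hmax (mul_nonneg hC0 hP0))

/-! ### Yu's published `G₁(n,1)` against `15(n+1)` and against the printed `(n+1) · 5.4 n` -/

/-- `G₁^ℚ(n) ≥ 15 (n+1)` for `n ≥ 2` (`(2 + log 7)n + 5.84 ≥ 13.64` and its logarithm is `≥ 2`).
[cite: Yu2013, (1.11)] -/
theorem yuG1Rat_ge {n : ℕ} (hn : 2 ≤ n) : 15 * ((n : ℝ) + 1) ≤ yuG1Rat n := by
  rw [yuG1Rat_def]
  have hn0 : (0 : ℝ) ≤ n + 1 := by positivity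
  have hnR : (2 : ℝ) ≤ n := by exact_mod_cast hn
  have ha : (1.9 : ℝ) < Real.log 7 := log_seven_gt_d1
  set x := (2 + Real.log 7) * n + 5.84 with hx
  have hx13 : (13.64 : ℝ) < x := by rw [hx]; nlinarith
  have hlog2 : (2 : ℝ) < Real.log x := by
    rw [Real.lt_log_iff_exp_lt (by linarith)]
    linarith [exp_two_lt_d2]
  rw [mul_comm]
  apply mul_le_mul_of_nonneg_left _ hn0
  linarith

/-- `3.16 < log 29.24` (`e^{79} < 29.24^{25}`). [folklore] -/
theorem log_d2924_gt : (3.16 : ℝ) < Real.log 29.24 := by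
  rw [Real.lt_log_iff_exp_lt (by norm_num)]
  have h25 : Real.exp 3.16 ^ 25 = Real.exp 79 := by rw [← Real.exp_nat_mul]; norm_num
  have h79 : Real.exp 79 < (29.24 : ℝ) ^ 25 := by
    calc Real.exp 79 = Real.exp 1 ^ 79 := by rw [Real.exp_one_pow]; norm_num
      _ < 2.7182818286 ^ 79 := by gcongr; exact Real.exp_one_lt_d9
      _ < (29.24 : ℝ) ^ 25 := by norm_num
  have h : Real.exp 3.16 ^ 25 < (29.24 : ℝ) ^ 25 := by rw [h25]; exact h79
  exact lt_of_pow_lt_pow_left₀ 25 (by norm_num) h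

/-- **The printed `(n+1) · 5.4 n` is below `G₁^ℚ(n)` for `n ≤ 6`** (`log 7 > 1.9`; cases `n ≤ 3`,
`n ∈ {4, 5}` via `log 21.44 > 3`, `n = 6` via `log 29.24 > 3.16`), so in this range every bound with
`max(log B, (n+1) · 5.4n)` implies the one with `max(log B, G₁^ℚ(n))` — in particular the elementary
`Stewart2013_lemma5_rat_of_le_one` (`n ≤ 1`) yields the restated fact for `n ≤ 1`.
[cite: Stewart2013, proof of Lemma 5, (19); Yu2013, (1.11), (1.30)–(1.31)] -/
theorem printed_le_yuG1Rat {n : ℕ} (hn : n ≤ 6) :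
    ((n : ℝ) + 1) * (5.4 * n) ≤ yuG1Rat n := by
  rw [yuG1Rat_def]
  have hn0 : (0 : ℝ) ≤ n + 1 := by positivity
  apply mul_le_mul_of_nonneg_left _ hn0
  have ha : (1.9 : ℝ) < Real.log 7 := log_seven_gt_d1
  have hnR0 : (0 : ℝ) ≤ n := Nat.cast_nonneg n
  set x := (2 + Real.log 7) * n + 5.84 with hx
  have hxlo : 3.9 * (n : ℝ) + 5.84 ≤ x := by rw [hx]; nlinarith
  have hx1 : (1 : ℝ) ≤ x := by linarith
  have hlog0 : 0 ≤ Real.log x := Real.log_nonneg hx1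
  rcases Nat.lt_or_ge n 4 with h3 | h4
  · -- `n ≤ 3`: `1.5 n ≤ 4.5 ≤ 5.84`
    have hnR : (n : ℝ) ≤ 3 := by exact_mod_cast Nat.lt_succ_iff.mp h3
    nlinarith
  rcases Nat.lt_or_ge n 6 with h5 | h6
  · -- `n ∈ {4, 5}`: `log x > 3` (`x ≥ 21.44 > e³`) and `1.5 n ≤ 7.5 ≤ 8.84`
    have hnR4 : (4 : ℝ) ≤ n := by exact_mod_cast h4
    have hnR5 : (n : ℝ) ≤ 5 := by exact_mod_cast Nat.lt_succ_iff.mp h5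
    have hx21 : (21.44 : ℝ) ≤ x := by linarith
    have hexp3 : Real.exp 3 < 20.1 := by
      calc Real.exp 3 = Real.exp 1 ^ 3 := by rw [Real.exp_one_pow]; norm_num
        _ < 2.7182818286 ^ 3 := by gcongr; exact Real.exp_one_lt_d9
        _ < 20.1 := by norm_num
    have hlog3 : (3 : ℝ) < Real.log x := by
      rw [Real.lt_log_iff_exp_lt (by linarith)]
      linarith
    nlinarith
  · -- `n = 6`: `log x ≥ log 29.24 > 3.16` and `32.4 ≤ 23.4 + 5.84 + 3.16`
    have hn6 : n = 6 := le_antisymm hn h6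
    subst hn6
    have hx29 : (29.24 : ℝ) ≤ x := by
      have : (3.9 : ℝ) * ((6 : ℕ) : ℝ) + 5.84 = 29.24 := by norm_num
      linarith
    have hlog : (3.16 : ℝ) < Real.log x :=
      lt_of_lt_of_le log_d2924_gt (Real.log_le_log (by norm_num) hx29)
    have : (5.4 : ℝ) * ((6 : ℕ) : ℝ) = 32.4 := by norm_num
    have : (3.9 : ℝ) * ((6 : ℕ) : ℝ) = 23.4 := by norm_num
    linarith

/-- `log 33.5 < 3.55` (`33.5^{20} < e^{71}`). [folklore] -/
theorem log_d335_lt : Real.log 33.5 < 3.55 := by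
  rw [Real.log_lt_iff_lt_exp (by norm_num)]
  have h20 : Real.exp 3.55 ^ 20 = Real.exp 71 := by rw [← Real.exp_nat_mul]; norm_num
  have h71 : (33.5 : ℝ) ^ 20 < Real.exp 71 := by
    calc (33.5 : ℝ) ^ 20 < 2.7182818283 ^ 71 := by norm_num
      _ < Real.exp 1 ^ 71 := by gcongr; exact Real.exp_one_gt_d9
      _ = Real.exp 71 := by rw [Real.exp_one_pow]; norm_num
  have h : (33.5 : ℝ) ^ 20 < Real.exp 3.55 ^ 20 := by rw [h20]; exact h71
  exact lt_of_pow_lt_pow_left₀ 20 (Real.exp_pos _).le h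

/-- **`G₁^ℚ(n) ≤ (n+1) · 5.4 n` for `n ≥ 7`**: the printed step (19) = (3.4) of Stewart's proof,
taken with Yu's published `a₁⁽¹⁾ = a₂⁽¹⁾ = 5.84` (`d = 1`), holds from `n = 7` on (`log 7 < 1.95`,
`log 33.5 < 3.55` and concavity `log y ≤ log 33.5 + y/33.5 − 1`; at `n = 7` the two sides are
`36.97… · 8` and `37.8 · 8`, whereas at `n = 6` they are `32.90… · 7 > 32.4 · 7`).
[cite: Stewart2013, proof of Lemma 5, (19); Yu2013, (1.11), (1.30)–(1.31)] -/
theorem yuG1Rat_le_printed {n : ℕ} (hn : 7 ≤ n) :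
    yuG1Rat n ≤ ((n : ℝ) + 1) * (5.4 * n) := by
  rw [yuG1Rat_def]
  have hn0 : (0 : ℝ) ≤ n + 1 := by positivity
  apply mul_le_mul_of_nonneg_left _ hn0
  have ha : (1.9 : ℝ) < Real.log 7 := log_seven_gt_d1
  have hb : Real.log 7 < 1.95 := log_seven_lt_d2
  have hnR : (7 : ℝ) ≤ n := by exact_mod_cast hn
  set x := (2 + Real.log 7) * n + 5.84 with hx
  have hxlo : 3.9 * (n : ℝ) + 5.84 < x := by rw [hx]; nlinarith
  have hxup : x < 3.95 * (n : ℝ) + 5.84 := by rw [hx]; nlinarith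
  have hx0 : (0 : ℝ) < x := by linarith
  have hlogx : Real.log x ≤ Real.log 33.5 + (x / 33.5 - 1) := by
    have hsplit : Real.log x = Real.log 33.5 + Real.log (x / 33.5) := by
      rw [← Real.log_mul (by norm_num) (by positivity)]
      congr 1
      field_simp
    rw [hsplit]
    have := Real.log_le_sub_one_of_pos (show 0 < x / 33.5 by positivity)
    linarith
  have h335 := log_d335_lt
  have hdiv : x / 33.5 < (3.95 * (n : ℝ) + 5.84) / 33.5 := by gcongr
  have hfin : x + Real.log x < 3.95 * n + 5.84 + 3.55 + ((3.95 * n + 5.84) / 33.5 - 1) := by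
    linarith
  have hkey : 3.95 * (n : ℝ) + 5.84 + 3.55 + ((3.95 * n + 5.84) / 33.5 - 1) ≤ 5.4 * n := by
    field_simp
    nlinarith
  linarith

/-! ### The glue: Yu's Theorem I over `ℚ` ⇒ the named fact; the fact ⇒ the printed form -/

/-- **Yu's Theorem I over `ℚ` (in Stewart's display form (P), with Yu's published `G₁(n,1)`)
implies the named fact `Stewart2013_lemma5_rat` (proved glue).** Hypothesis `H` is, for every
`n ≥ 2`, the display (P) of Stewart's proof over `ℚ` with `G₁^ℚ = yuG1Rat` in place of Stewart's
`G₁`: `ord_p(Ξ − 1) < C₁ h(α₁)⋯h(αₙ) max(log B, G₁^ℚ(n), (n+1) log p)`, `C₁ = stewartC1 n p δ`. It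
is what [Yu2013, Main Theorem (1.18) with `i = 1`, i.e. Theorem I] gives for `K = ℚ`, `p ≥ 5`
(case (III.2): `e_℘ = f_℘ = d = 1`, `q = 2`, `u = 1`, `c⁽¹⁾ = 1790 ≤ 1794`, `a₁⁽¹⁾ = a₂⁽¹⁾ = 5.84`)
after the elementary remarks of Stewart's proof: (1.17) holds after re-indexing (the conclusion is
symmetric in the indices); `δ_Stewart ≤ δ(a)` ((1.8), `δ(a) ≥ 1`) and `C₁` is non-increasing in
`δ`; `B_Yu = min_{bⱼ ≠ 0} |bⱼ| ≤ B`; and the first term of `h⁽¹⁾` (1.13) is `≤ log B` because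
`ω(1) = log 2 · log 3/log 6` and two multiplicatively independent rationals have heights `≥ log 2`
and `≥ log 3` (over `ℚ` no Dobrowolski–Voutier bound is needed). NOT proved here: `H` itself
(p-adic logarithmic forms). Proof of the glue: `n ≥ 2` by
`Stewart2013_lemma5_rat_maxG_of_printedYuBound` with `G = G₁^ℚ(n)` (`yuG1Rat_ge`); `n ≤ 1`
unconditionally by `Stewart2013_lemma5_rat_of_le_one` and `printed_le_yuG1Rat`.
[cite: Stewart2013, proof of Lemma 5, (17)–(18); Yu2013, Main Theorem (1.18), (1.9), (1.11),
(1.13)–(1.15), §1.3 case (III.2)] -/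
theorem Stewart2013_lemma5_rat_of_yuBound
    (H : ∀ (n p : ℕ) (α : Fin n → ℚ) (b : Fin n → ℤ), 2 ≤ n → p.Prime → 5 ≤ p →
      (∀ i, α i ≠ 0 ∧ padicValRat p (α i) = 0) →
      (∀ e : Fin n → ℤ, ∏ i, α i ^ e i = 1 → e = 0) → b ≠ 0 →
      (padicValRat p (∏ i, α i ^ b i - 1) : ℝ) <
        stewartC1 n p (stewartDelta p α) * (∏ i, logHeight₁ (α i)) *
          max (Real.log (stewartB b)) (max (yuG1Rat n) ((n + 1) * Real.log p))) :
    Stewart2013_lemma5_rat := by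
  intro n p α b hp hp5 hα hind hb
  rcases Nat.lt_or_ge n 2 with hn1 | hn2
  · -- `n ≤ 1`: elementary, printed form, then `(n+1)·5.4n ≤ G₁^ℚ(n)`
    have h1 := Stewart2013_lemma5_rat_of_le_one n p (by omega) α b hp hp5 hα hind hb
    have hmax : max (Real.log (stewartB b)) (((n : ℝ) + 1) * (5.4 * n)) ≤
        max (Real.log (stewartB b)) (yuG1Rat n) :=
      max_le_max le_rfl (printed_le_yuG1Rat (by omega))
    have hC0 : 0 ≤ stewartC n p (stewartDelta p α) :=
      le_trans (by
        have hL : 0 ≤ Real.log p := Real.log_natCast_nonneg p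
        positivity) (stewartC_ge n hp5 (stewartDelta p α))
    have hP0 : 0 ≤ ∏ i, logHeight₁ (α i) := Finset.prod_nonneg fun i _ => zero_le_logHeight₁ _
    exact lt_of_lt_of_le h1 (mul_le_mul_of_nonneg_left hmax (mul_nonneg hC0 hP0))
  · exact Stewart2013_lemma5_rat_maxG_of_printedYuBound n p α b (yuG1Rat n) hn2 hp5
      (fun i => (hα i).1) hind (yuG1Rat_ge hn2) (H n p α b hn2 hp hp5 hα hind hb)

/-- **The named fact implies the PRINTED Lemma 5 over `ℚ` outside the corner `2 ≤ n ≤ 6, B > 10⁸`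
(proved):** from `Stewart2013_lemma5_rat`, the printed conclusion
`ord_p(Ξ − 1) < C h(α₁)⋯h(αₙ) max(log B, (n+1) · 5.4n)` holds whenever `7 ≤ n` (by
`yuG1Rat_le_printed`, i.e. step (19) with Yu's constants), or `n ≤ 1`
(`Stewart2013_lemma5_rat_of_le_one`, unconditionally), or `B ≤ 10⁸`
(`Stewart2013_lemma5_rat_of_stewartB_le`, unconditionally). For `2 ≤ n ≤ 6` and `B > 10⁸` the
printed form is not established in print (see the *Restatement record* in
`StewartYuPadicLogForms.lean`). [cite: Stewart2013, Lemma 5 = Lemma 3.1, and its proof (19)] -/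
theorem Stewart2013_lemma5_rat.printed_of (h : Stewart2013_lemma5_rat)
    (n p : ℕ) (α : Fin n → ℚ) (b : Fin n → ℤ) (hp : p.Prime) (hp5 : 5 ≤ p)
    (hα : ∀ i, α i ≠ 0 ∧ padicValRat p (α i) = 0)
    (hind : ∀ e : Fin n → ℤ, ∏ i, α i ^ e i = 1 → e = 0) (hb : b ≠ 0)
    (hcase : 7 ≤ n ∨ n ≤ 1 ∨ stewartB b ≤ 10 ^ 8) :
    (padicValRat p (∏ i, α i ^ b i - 1) : ℝ) <
      stewartC n p (stewartDelta p α) * (∏ i, logHeight₁ (α i)) *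
        max (Real.log (stewartB b)) ((n + 1) * (5.4 * n)) := by
  rcases hcase with h7 | h1 | hB
  · have hfact := h n p α b hp hp5 hα hind hb
    have hmax : max (Real.log (stewartB b)) (yuG1Rat n) ≤
        max (Real.log (stewartB b)) (((n : ℝ) + 1) * (5.4 * n)) :=
      max_le_max le_rfl (yuG1Rat_le_printed h7)
    have hC0 : 0 ≤ stewartC n p (stewartDelta p α) :=
      le_trans (by
        have hL : 0 ≤ Real.log p := Real.log_natCast_nonneg p
        positivity) (stewartC_ge n hp5 (stewartDelta p α))
    have hP0 : 0 ≤ ∏ i, logHeight₁ (α i) := Finset.prod_nonneg fun i _ => zero_le_logHeight₁ _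
    exact lt_of_lt_of_le hfact (mul_le_mul_of_nonneg_left hmax (mul_nonneg hC0 hP0))
  · exact Stewart2013_lemma5_rat_of_le_one n p h1 α b hp hp5 hα hind hb
  · exact Stewart2013_lemma5_rat_of_stewartB_le n p α b hp hp5 hα hind hb hB

end Literature.NumberTheory.DiophantineGeometry.Dioph
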